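import Summits.ResolutionOfSingularities.ResolutionOfSingularities.Theorems.WeightedInvariantSuccOverCentreModel
import Summits.ResolutionOfSingularities.ResolutionOfSingularities.Theorems.WeightedInvariantPlusChartSections
import Summits.ResolutionOfSingularities.ResolutionOfSingularities.Theorems.WeightedInvariantELadderTwoCompatible
import Summits.ResolutionOfSingularities.ResolutionOfSingularities.Theorems.WeightedInvariantELadderOneProductCentre
import Summits.ResolutionOfSingularities.ResolutionOfSingularities.Theorems.WeightedInvariantELadderOneSingOverSupport
import Summits.ResolutionOfSingularities.ResolutionOfSingularities.Theorems.WeightedInvariantGradedCoarsening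
import Literature.AlgebraicGeometry.Resolution.SmoothStalksRegular
import HarnessLib

/-!
# E2 tier, (S-b2-over): THE COBORDANT LOCAL MODEL OVER THE CENTRE — `Stage.SuccOverCentreAt` at a successor read point over the support

Route `ResolutionOfSingularities/WeightedInvariant`, crux `Theses.WeightedInvariant.HypersurfaceCentreConstruction`
(stmt-ResolutionOfSingularities-19897), door line `local-engine`, E2 tier; piece (S-b2-over') of the registered stub `stub_e2_step_h`
(res-L1-w43-plan-1 SPEC (Δ6b) rev 6 `HOME/L/res-L1-w43-plan-1/E2Step_split_sketch.lean` 6d21cd592fd98c12, OFFER (o59-b2-over)).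

`ELadderOne.succOverCentreAt_of_inducedAlongCover` — for a stage `S`, an admissible centre `R` with Rees filtration `R'`, a successor presentation
whose rank-`j+1` atlas `𝒜'` is `InducedAlongCover S R R' Dg ρ 𝒜'`, and a READ point `η'` of the successor (`η' ∈ genSing₂ S'`) whose base point
`y = σ₊ η'` is a read point of `S` (the (S-b2-below) reading, taken as a hypothesis) and lies in `supp R`: `S.SuccOverCentreAt R S' σ₊ η'`.  For EVERY
presentation `(u, w)` of the stalk filtration of `R` at `y`:
* MODEL — the K4-E chart form WITH the coefficient map (`exists_gameSide_stalk_model_of_plusChartFac_coeff`, …PlusStalkGameSideCoeff) at the STALK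
  `A' = 𝒪_{Y,y}` (a localisation of `Γ(Y, W)` at the prime of `y`, `IsAffineOpen.isLocalization_stalk`) with `I'ₙ = 𝒥ₙ(W)·𝒪_{Y,y} = (u^α : w·α ≥ n)`:
  the carrier IS `cobordantAlgebra' u w`; compatibility on all of `𝒪_{Y,y}` by `IsLocalization.ringHom_ext`;
* `t⁻¹ ∈ 𝔫` — `extReesAlgebra.tInv_mem_of_forall_le_comap` (`y ∈ supp R`);
* `t`-HOMOGENEITY — the successor chart `W' a' ∋ η'` over a unit chart `W (oc a') ∋ y` (COVER/UNITS of `InducedAlongCover` over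
  `exists_unitChart_of_mem_singImage`) is a unit chart, so `𝔭(η') ⊆ Γ(B₊, W' a')` is homogeneous (`Stage.IsOrbitGeneric`), hence homogeneous for
  the LAST-COORDINATE coarsening (`GradedCoarsening.coarsen`, res-D-pv-031) in which `σ₊♯ Γ(Y, W)` has degree `0` and `tInvOn` degree `−1`
  (the dictionary); the chart sections `ρ` of …PlusChartSections read the coefficient map on germs (`germ (ρ z) = Ψ⁻¹ ((ℓ z)/1)`), and the graded
  bookkeeping of …SuccTHomogeneous concludes;
* LOCAL EQUATION — `exists_factor_strictTransform_eq_of_presentation` (…SuccOverCentreRing) on the chart of the centre at `y`, K4-E (I), the saturation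
  kit of …CentreAssemblyExcModel, and `Associated` in the domain `𝒪_{B₊,η'}`.
`LocalEngine.e2AtlasOverCentre (p) : <E2AtlasOverCentreBody p VERBATIM>`.
Def-free; OURS bookkeeping; nothing here is a claim about Hironaka's problem; AI-written, weaker than expert review.
[cite: Wlodarczyk2022, Def. 5.1.1; 3.3.12; §2.3.9]
-/

noncomputable section

set_option linter.dupNamespace false -- mandated namespace of this single-conjunct summit

open CategoryTheory AlgebraicGeometry TopologicalSpace IsLocalRing
open scoped LaurentPolynomial
open LaurentPolynomial DirectSum
open Literature.AlgebraicGeometry.Resolution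
open Summit.ResolutionOfSingularities.ResolutionOfSingularities.Theorems
open Summit.ResolutionOfSingularities.ResolutionOfSingularities.Cruxes.HypersurfaceCentreConstruction.LocalEngine

namespace Summit.ResolutionOfSingularities.ResolutionOfSingularities.Theorems.ELadderOne

variable {k : Type} [Field k]

/-- **(S-b2-over) THE COBORDANT LOCAL MODEL OVER THE CENTRE.**  See the module docstring. [cite: Wlodarczyk2022, Def. 5.1.1; 3.3.12; §2.3.9] -/
theorem succOverCentreAt_of_inducedAlongCover (S : Stage k) (R : ReesAlgebraData S.Y)
    (hadm : IsAdmissibleCentre S.f S.i.ker R) (R' : ReesFiltration S.Y) (hR' : R'.ideal = R.piece)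
    [Smooth (R'.πPlus ≫ S.f)] [IsSeparated (R'.πPlus ≫ S.f)] [QuasiCompact (R'.πPlus ≫ S.f)]
    [IsIntegral (R'.strictTransformPlus S.i.ker).subscheme]
    (hlp' : IsLocallyPrincipal (R'.strictTransformPlus S.i.ker).subschemeι.ker)
    (Dg : ℕ) (V' : Scheme.{0}) (ρ : V' ⟶ S.V) [IsIntegral V'] [IsProper ρ]
    (q' : (R'.strictTransformPlus S.i.ker).subscheme ⟶ V')
    (hq' : q' ≫ ρ ≫ S.g = (R'.strictTransformPlus S.i.ker).subschemeι ≫ R'.πPlus ≫ S.f)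
    (𝒜' : GradedAtlas (S.j + 1) (R'.πPlus ≫ S.f) (R'.strictTransformPlus S.i.ker).subschemeι q')
    (hind : ∃ (oc : 𝒜'.ι → S.atlas.ι)
        (hle : ∀ a' : 𝒜'.ι,
          (𝒜'.W a' : (R'.plus : Scheme.{0}).Opens) ≤ R'.πPlus ⁻¹ᵁ (S.atlas.W (oc a') : S.Y.Opens)),
        𝒜'.exponent = S.atlas.exponent * Dg ∧
        (∀ (x' : ↥(R'.strictTransformPlus S.i.ker).subscheme) (a : S.atlas.ι),
          R'.πPlus.base ((R'.strictTransformPlus S.i.ker).subschemeι.base x') ∈ (S.atlas.W a : S.Y.Opens) →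
          ∃ a' : 𝒜'.ι, oc a' = a ∧
            (R'.strictTransformPlus S.i.ker).subschemeι.base x' ∈ (𝒜'.W a' : (R'.plus : Scheme.{0}).Opens)) ∧
        (∀ (a' : 𝒜'.ι) (e : ℕ),
          (∀ χ : Fin S.j → ℤ, ∃ s ∈ S.atlas.piece (oc a') (e • χ), IsUnit (S.i.app (S.atlas.W (oc a')) s)) →
          ∀ χ' : Fin (S.j + 1) → ℤ, ∃ s' ∈ 𝒜'.piece a' ((e * Dg) • χ'),
            IsUnit ((R'.strictTransformPlus S.i.ker).subschemeι.app (𝒜'.W a') s')) ∧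
        ∀ a' : 𝒜'.ι,
          (∀ (χ : Fin S.j → ℤ) (s : Γ(S.Y, S.atlas.W (oc a'))), s ∈ S.atlas.piece (oc a') χ →
            R'.πPlus.appLE (S.atlas.W (oc a')) (𝒜'.W a') (hle a') s ∈
              𝒜'.piece a' (Fin.snoc (α := fun _ => ℤ) χ 0)) ∧
          tInvOn R' (𝒜'.W a') ∈ 𝒜'.piece a' (Fin.snoc (α := fun _ => ℤ) 0 (-1)) ∧
          ∃ (β : Γ(S.Y, S.atlas.W (oc a'))) (η : Γ((R'.plus : Scheme.{0}), 𝒜'.W a')),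
            β ∈ (R.piece Dg).ideal (S.atlas.W (oc a')) ∧ β ∈ S.atlas.piece (oc a') 0 ∧ IsUnit η ∧
            η ∈ 𝒜'.piece a' (Fin.snoc (α := fun _ => ℤ) 0 (Dg : ℤ)) ∧
            η * tInvOn R' (𝒜'.W a') ^ Dg = R'.πPlus.appLE (S.atlas.W (oc a')) (𝒜'.W a') (hle a') β ∧
            (∀ y' : (R'.plus : Scheme.{0}), y' ∈ (𝒜'.W a' : (R'.plus : Scheme.{0}).Opens) ↔
              ∃ (O : (R'.plus : Scheme.{0}).affineOpens)
                (hO : (O : (R'.plus : Scheme.{0}).Opens) ≤ R'.πPlus ⁻¹ᵁ (S.atlas.W (oc a') : S.Y.Opens)),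
                y' ∈ (O : (R'.plus : Scheme.{0}).Opens) ∧ ∃ η₀ : Γ((R'.plus : Scheme.{0}), O),
                  IsUnit η₀ ∧ η₀ * tInvOn R' O ^ Dg = R'.πPlus.appLE (S.atlas.W (oc a')) O hO β) ∧
            (∀ s ∈ 𝒜'.piece a' 0, ∃ (l : ℕ) (x : Γ(S.Y, S.atlas.W (oc a'))),
              x ∈ (R.piece (Dg * l)).ideal (S.atlas.W (oc a')) ∧ x ∈ S.atlas.piece (oc a') 0 ∧
                s * η ^ l * tInvOn R' (𝒜'.W a') ^ (Dg * l) =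
                  R'.πPlus.appLE (S.atlas.W (oc a')) (𝒜'.W a') (hle a') x) ∧
            (∀ (l : ℕ) (x : Γ(S.Y, S.atlas.W (oc a'))), x ∈ (R.piece (Dg * l)).ideal (S.atlas.W (oc a')) →
              x ∈ S.atlas.piece (oc a') 0 → ∃ s ∈ 𝒜'.piece a' 0,
                s * η ^ l * tInvOn R' (𝒜'.W a') ^ (Dg * l) =
                  R'.πPlus.appLE (S.atlas.W (oc a')) (𝒜'.W a') (hle a') x) ∧
            (∀ x : Γ(S.Y, S.atlas.W (oc a')), R'.πPlus.appLE (S.atlas.W (oc a')) (𝒜'.W a') (hle a') x ∈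
              (R'.strictTransformPlus S.i.ker).ideal (𝒜'.W a') → x * β ∈ S.i.ker.ideal (S.atlas.W (oc a'))) ∧
            ∃ b : Γ(S.V, S.atlas.U (oc a')),
              b ∈ ((((R.piece Dg).comap S.i).subschemeι ≫ S.q).ker).ideal (S.atlas.U (oc a')) ∧
              S.i.app (S.atlas.W (oc a')) β =
                S.q.appLE (S.atlas.U (oc a')) (S.i ⁻¹ᵁ (S.atlas.W (oc a'))) (S.atlas.preimage_eq (oc a')).le b ∧
              (𝒜'.U a' : V'.Opens) =
                blowupChart ρ ((((R.piece Dg).comap S.i).subschemeι ≫ S.q).ker) (S.atlas.U (oc a')) b)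
    (η' : (R'.plus : Scheme.{0}))
    (hη' : η' ∈ Stage.genSing₂ (⟨R'.plus, R'.πPlus ≫ S.f, (R'.strictTransformPlus S.i.ker).subscheme,
      (R'.strictTransformPlus S.i.ker).subschemeι, hlp', V', q', ρ ≫ S.g, hq', S.j + 1, 𝒜'⟩ : Stage k))
    (hyread : R'.πPlus.base η' ∈ S.genSing₂) (hys : R'.πPlus.base η' ∈ R.support) :
    S.SuccOverCentreAt R ⟨R'.plus, R'.πPlus ≫ S.f, (R'.strictTransformPlus S.i.ker).subscheme,
      (R'.strictTransformPlus S.i.ker).subschemeι, hlp', V', q', ρ ≫ S.g, hq', S.j + 1, 𝒜'⟩ R'.πPlus η' := by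
  classical
  haveI : IsLocallyNoetherian S.Y := LocallyOfFiniteType.isLocallyNoetherian S.f
  haveI : IsLocallyNoetherian R'.cobordantBlowup := S.isLocallyNoetherian_cobordantBlowup R hadm.1 R' hR'
  -- the read points
  have hysing : R'.πPlus.base η' ∈ singImage S.i.ker := hyread.1
  have hx'0 := Stage.mem_range_of_mem_singImage _ hη'.1
  obtain ⟨x', hx'⟩ := hx'0
  -- a unit chart `oc a' ∋ y` below; the successor chart `a' ∋ η'` over it (COVER), a unit chart (UNITS)
  have ha₀ := S.exists_unitChart_of_mem_singImage hysing
  obtain ⟨a₀, hya₀, hunit₀⟩ := ha₀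
  obtain ⟨oc, hle, hexp, hcover, hunits, hdict⟩ := hind
  have ha' := hcover x' a₀ (by rw [hx']; exact hya₀)
  obtain ⟨a', hoc, hη'a'⟩ := ha'
  subst hoc
  rw [hx'] at hη'a'
  have hua' : Stage.IsUnitChart (⟨R'.plus, R'.πPlus ≫ S.f, (R'.strictTransformPlus S.i.ker).subscheme,
      (R'.strictTransformPlus S.i.ker).subschemeι, hlp', V', q', ρ ≫ S.g, hq', S.j + 1, 𝒜'⟩ : Stage k) a' := by
    intro χ
    change ∃ s ∈ 𝒜'.piece a' (𝒜'.exponent • χ), _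
    rw [hexp]
    exact hunits a' S.atlas.exponent hunit₀ χ
  have hda' := hdict a'
  obtain ⟨hdσ, hdT, -⟩ := hda'
  -- the prime of `η'` on the unit chart `a'` is homogeneous (orbit-genericity)
  letI grΓ : GradedRing (𝒜'.piece a') := 𝒜'.gradedRing a'
  have hP' := (hη'.2.1 a' hua' hη'a').1
  -- notation
  set W₀ : S.Y.affineOpens := S.atlas.W (oc a')
  have hyW₀ : R'.πPlus.base η' ∈ (W₀ : S.Y.Opens) := hle a' hη'a'
  -- the K4-E chart over `W₀` and the point `x` under `η'`
  have hφ0 := exists_plusChartFac R' W₀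
  obtain ⟨φ, hφo, hφ⟩ := hφ0
  have hx0 := exists_plusChartFac_apply_eq R' W₀ φ hφ η' hyW₀
  obtain ⟨x, rfl⟩ := hx0
  have hq0 : ∃ q : PrimeSpectrum (R'.sectionsRing W₀), (R'.plusChart W₀).ι x = q := ⟨_, rfl⟩
  obtain ⟨q, hq⟩ := hq0
  haveI : q.asIdeal.IsPrime := q.isPrime
  have h𝔮 := (primeIdealOf_πPlus_plusChartFac_asIdeal R' W₀ φ hφ x q hq).symm
  -- the stalk of `Y` at `y` as a localisation of `Γ(Y, W₀)`
  letI algO : Algebra Γ(S.Y, W₀) (S.Y.presheaf.stalk (R'.πPlus.base (φ.base x))) :=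
    S.Y.presheaf.algebra_section_stalk (⟨R'.πPlus.base (φ.base x), hyW₀⟩ : (W₀ : S.Y.Opens))
  haveI hlocO : IsLocalization.AtPrime (S.Y.presheaf.stalk (R'.πPlus.base (φ.base x)))
      (W₀.2.primeIdealOf ⟨R'.πPlus.base (φ.base x), hyW₀⟩).asIdeal := W₀.2.isLocalization_stalk ⟨R'.πPlus.base (φ.base x), hyW₀⟩
  -- regularity / domains
  haveI hregO : IsRegularLocalRing (S.Y.presheaf.stalk (R'.πPlus.base (φ.base x))) :=
    isRegularLocalRing_stalk_of_smooth_of_field S.f _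
  haveI : IsDomain (S.Y.presheaf.stalk (R'.πPlus.base (φ.base x))) := isDomain_of_isRegularLocalRing _
  haveI hregB : IsRegularLocalRing ((R'.plus : Scheme.{0}).presheaf.stalk (φ.base x)) :=
    isRegularLocalRing_stalk_of_smooth_of_field (R'.πPlus ≫ S.f) _
  haveI : IsDomain ((R'.plus : Scheme.{0}).presheaf.stalk (φ.base x)) := isDomain_of_isRegularLocalRing _
  -- (C1) the chart sections over `W' a'`
  have hW'φ : (𝒜'.W a' : (R'.plus : Scheme.{0}).Opens) ≤ φ ''ᵁ ⊤ := fun y'' hy'' => by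
    obtain ⟨x'', hx''⟩ := exists_plusChartFac_apply_eq R' W₀ φ hφ y'' (hle a' hy'')
    exact ⟨x'', trivial, hx''⟩
  have hρs0 := exists_plusChartFac_sections_restrict R' W₀ φ hφ (𝒜'.W a') hW'φ
  obtain ⟨ρs, hρa, hρT, hρg⟩ := hρs0
  -- (C2) the last-coordinate coarsening of the successor chart grading
  have hgrℬ := GradedCoarsening.nonempty_gradedRing_coarsen (𝒜'.piece a')
    (Pi.evalAddMonoidHom (fun _ : Fin (S.j + 1) => ℤ) (Fin.last S.j))
  obtain ⟨grℬ⟩ := hgrℬ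
  letI := grℬ
  have hP'ℬ := GradedCoarsening.isHomogeneous_coarsen_of_isHomogeneous (𝒜 := 𝒜'.piece a')
    (f := Pi.evalAddMonoidHom (fun _ : Fin (S.j + 1) => ℤ) (Fin.last S.j)) hP'
  have hρC : ∀ a : Γ(S.Y, W₀), ρs (algebraMap Γ(S.Y, W₀) (R'.sectionsRing W₀) a) ∈
      GradedCoarsening.coarsen (𝒜'.piece a') (Pi.evalAddMonoidHom (fun _ : Fin (S.j + 1) => ℤ) (Fin.last S.j)) 0 := fun a => by
    letI grA : GradedRing (S.atlas.piece (oc a')) := S.atlas.gradedRing (oc a')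
    rw [hρa, ← DirectSum.sum_support_decompose (S.atlas.piece (oc a')) a, map_sum]
    refine AddSubgroup.sum_mem _ fun χ _ => ?_
    have h1 := hdσ χ _ (SetLike.coe_mem (DirectSum.decompose (S.atlas.piece (oc a')) a χ))
    have h2 := GradedCoarsening.mem_coarsen_of_mem (𝒜 := 𝒜'.piece a')
      (f := Pi.evalAddMonoidHom (fun _ : Fin (S.j + 1) => ℤ) (Fin.last S.j)) h1
    have h3 : Pi.evalAddMonoidHom (fun _ : Fin (S.j + 1) => ℤ) (Fin.last S.j) (Fin.snoc (α := fun _ => ℤ) χ 0) = 0 := by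
      rw [Pi.evalAddMonoidHom_apply]; exact Fin.snoc_last _ _
    rwa [h3] at h2
  have hρTℬ : ρs ⟨T (-1), (R'.filtration W₀).T_neg_one_mem_extendedRees⟩ ∈
      GradedCoarsening.coarsen (𝒜'.piece a') (Pi.evalAddMonoidHom (fun _ : Fin (S.j + 1) => ℤ) (Fin.last S.j)) (-1) := by
    have h2 := GradedCoarsening.mem_coarsen_of_mem (𝒜 := 𝒜'.piece a')
      (f := Pi.evalAddMonoidHom (fun _ : Fin (S.j + 1) => ℤ) (Fin.last S.j)) (hρT.symm ▸ hdT)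
    have h3 : Pi.evalAddMonoidHom (fun _ : Fin (S.j + 1) => ℤ) (Fin.last S.j)
        (Fin.snoc (α := fun _ => ℤ) (0 : Fin S.j → ℤ) (-1)) = -1 := by
      rw [Pi.evalAddMonoidHom_apply]; exact Fin.snoc_last _ _
    rwa [h3] at h2
  -- `P' = germ⁻¹ 𝔪_{η'}`
  have hPg : ((𝒜'.W a').2.primeIdealOf ⟨φ.base x, hη'a'⟩).asIdeal =
      (maximalIdeal _).comap ((R'.plus : Scheme.{0}).presheaf.germ (𝒜'.W a') (φ.base x) hη'a').hom := by
    rw [IsAffineOpen.primeIdealOf_eq_map_closedPoint]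
    rfl
  -- the chart of the centre at `y`: a positively weighted family with independent differentials
  have hch := hadm.1 (R'.πPlus.base (φ.base x))
  obtain ⟨U₁, hyU₁, m₁, u₁, w₁, hchart⟩ := hch
  have hv𝔪 : ∀ i, (S.Y.presheaf.germ U₁ _ hyU₁).hom (u₁ i) ∈ maximalIdeal _ := fun i => by
    have h := (ReesAlgebraData.IsWeightedChart.mem_support_iff R hchart hyU₁).mp hys i
    rw [IsLocalRing.mem_maximalIdeal, mem_nonunits_iff]
    exact fun hunit => h ((S.Y.mem_basicOpen (u₁ i) _ hyU₁).mpr hunit)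
  have hli := hchart.linearIndependent _ hyU₁ hv𝔪
  have hprY : ∃ g, stalkIdeal S.i.ker (R'.πPlus.base (φ.base x)) = Ideal.span {g} :=
    (S.isLocallyPrincipal _).isPrincipal_stalkIdeal.principal
  have hγ := stalkIdeal_eq_span_localGenerator S.i.ker (R'.πPlus.base (φ.base x)) hprY
  have hfy0 : localGenerator S.i.ker (R'.πPlus.base (φ.base x)) ≠ 0 :=
    ne_zero_of_mem_singImage_of_stalkIdeal_eq S.i.ker hγ hysing
  have hker : (R'.strictTransformPlus S.i.ker).subschemeι.ker = R'.strictTransformPlus S.i.ker :=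
    Scheme.IdealSheafData.ker_subschemeι _
  have hprB : ∃ g, stalkIdeal (R'.strictTransformPlus S.i.ker).subschemeι.ker (φ.base x) = Ideal.span {g} :=
    (hlp' (φ.base x)).isPrincipal_stalkIdeal.principal
  have hγ' : stalkIdeal (R'.strictTransformPlus S.i.ker) (φ.base x) =
      Ideal.span {localGenerator (R'.strictTransformPlus S.i.ker).subschemeι.ker (φ.base x)} :=
    (congrArg (fun I => stalkIdeal I (φ.base x)) hker).symm.trans
      (stalkIdeal_eq_span_localGenerator (R'.strictTransformPlus S.i.ker).subschemeι.ker (φ.base x) hprB)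
  have hXU : (S.i.ker.ideal W₀).map (algebraMap Γ(S.Y, W₀) (S.Y.presheaf.stalk (R'.πPlus.base (φ.base x)))) =
      Ideal.span {localGenerator S.i.ker (R'.πPlus.base (φ.base x))} := by
    rw [← hγ, stalkIdeal_eq_map_germ S.i.ker W₀ hyW₀]
    rfl
  -- now the presentation `(u, w)` of the stalk filtration
  intro n u w hu
  have hI' : ∀ m, weightedMonomialIdeal u w m =
      ((R'.ideal m).ideal W₀).map (algebraMap Γ(S.Y, W₀) (S.Y.presheaf.stalk (R'.πPlus.base (φ.base x)))) := fun m =>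
    (hu m).trans ((congrArg (fun J : S.Y.IdealSheafData => stalkIdeal J (R'.πPlus.base (φ.base x)))
      (congrFun hR' m).symm).trans (stalkIdeal_eq_map_germ (R'.ideal m) W₀ hyW₀))
  have hsupp : ∀ m, 0 < m → weightedMonomialIdeal u w m ≤ maximalIdeal _ := fun m hm =>
    (hu m).le.trans ((mem_support_iff_stalkIdeal_le (R.piece m) _).mp ((R.mem_support_iff.mp hys) m hm))
  have huv : ∀ m, weightedMonomialIdeal u w m =
      weightedMonomialIdeal (fun i => (S.Y.presheaf.germ U₁ _ hyU₁).hom (u₁ i)) w₁ m := fun m =>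
    (hu m).trans (((stalkIdeal_eq_map_germ (R.piece m) U₁ hyU₁).trans
      (congrArg (Ideal.map (S.Y.presheaf.germ U₁ _ hyU₁).hom) (hchart.ideal_eq m))).trans
        (weightedMonomialIdeal_map _ u₁ w₁ m))
  exact exists_succOverCentre_model R' W₀ φ hφ x q hq hyW₀ _ h𝔮 u w hI' (𝒜'.W a') hη'a' ρs (fun z => hρg x hη'a' z)
    (GradedCoarsening.coarsen (𝒜'.piece a') (Pi.evalAddMonoidHom (fun _ : Fin (S.j + 1) => ℤ) (Fin.last S.j)))
    hρC hρTℬ hP'ℬ hPg hsupp _ w₁ hchart.w_pos hv𝔪 hli huv S.i.ker _ hfy0 hXU _ hγ'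
    (R'.πPlus.stalkMap (φ.base x)).hom (fun _ => rfl)

end Summit.ResolutionOfSingularities.ResolutionOfSingularities.Theorems.ELadderOne

namespace Summit.ResolutionOfSingularities.ResolutionOfSingularities.Cruxes.HypersurfaceCentreConstruction.LocalEngine

open Summit.ResolutionOfSingularities.ResolutionOfSingularities.Theorems.ELadderOne

/-- **(S-b2-over') `E2AtlasOverCentreBody p`, VERBATIM** (res-L1-w43-plan-1 SPEC (Δ6b) rev 6 `E2AtlasOverCentreBody`, = the hypothesis
`hover p _` of res-D-pv-031's `stub_e2_step_h_of_over`, …ELadderTwoStepAssembly): for a non-regular (I0)₂ stage, an admissible centre `R`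
with the generic point of `X` off the support, its Rees filtration `R'`, the induced successor presentation `(V', ρ, q', σ_X, 𝒜')`
(`InducedAlongCover`, spelled out) and the (S-b2-below) readings, every successor read point `η'` over `supp R` has the cobordant local
model `S.SuccOverCentreAt R S' σ₊ η'` — by `succOverCentreAt_of_inducedAlongCover`; the hypotheses `CharP`, `PerfectField`, `InvDim₂`,
`¬ IsRegular`, `S.i ξ ∉ supp R`, `0 < Dg`, `IsBlowup ρ`, `σ_X` and (I0)₂ of the successor are not used. [OURS]
[cite: Wlodarczyk2022, Def. 5.1.1; 3.3.12; §2.3.9] -/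
theorem e2AtlasOverCentre (p : ℕ) :
    ∀ ⦃k : Type⦄ [Field k] [CharP k p] [PerfectField k] (S : Stage k), S.InvDim₂ → ¬ Scheme.IsRegular S.X →
      ∀ (R : ReesAlgebraData S.Y), IsAdmissibleCentre S.f S.i.ker R → S.i (genericPoint S.X) ∉ R.support →
        ∀ (R' : ReesFiltration S.Y), R'.ideal = R.piece →
      ∀ [Smooth (R'.πPlus ≫ S.f)] [IsSeparated (R'.πPlus ≫ S.f)] [QuasiCompact (R'.πPlus ≫ S.f)]
        [IsIntegral (R'.strictTransformPlus S.i.ker).subscheme]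
        (hlp' : IsLocallyPrincipal (R'.strictTransformPlus S.i.ker).subschemeι.ker)
        (Dg : ℕ) (_ : 0 < Dg)
        (V' : Scheme.{0}) (ρ : V' ⟶ S.V) [IsIntegral V'] [IsProper ρ]
        (_ : IsBlowup ρ ((((R.piece Dg).comap S.i).subschemeι ≫ S.q).ker))
        (q' : (R'.strictTransformPlus S.i.ker).subscheme ⟶ V')
        (hq' : q' ≫ ρ ≫ S.g = (R'.strictTransformPlus S.i.ker).subschemeι ≫ R'.πPlus ≫ S.f)
        (σX : (R'.strictTransformPlus S.i.ker).subscheme ⟶ S.X)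
        (_ : σX ≫ S.i = (R'.strictTransformPlus S.i.ker).subschemeι ≫ R'.πPlus) (_ : q' ≫ ρ = σX ≫ S.q)
        (𝒜' : GradedAtlas (S.j + 1) (R'.πPlus ≫ S.f) (R'.strictTransformPlus S.i.ker).subschemeι q'),
      (∃ (oc : 𝒜'.ι → S.atlas.ι)
          (hle : ∀ a' : 𝒜'.ι,
            (𝒜'.W a' : (R'.plus : Scheme.{0}).Opens) ≤ R'.πPlus ⁻¹ᵁ (S.atlas.W (oc a') : S.Y.Opens)),
          𝒜'.exponent = S.atlas.exponent * Dg ∧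
          (∀ (x' : ↥(R'.strictTransformPlus S.i.ker).subscheme) (a : S.atlas.ι),
            R'.πPlus.base ((R'.strictTransformPlus S.i.ker).subschemeι.base x') ∈ (S.atlas.W a : S.Y.Opens) →
            ∃ a' : 𝒜'.ι, oc a' = a ∧
              (R'.strictTransformPlus S.i.ker).subschemeι.base x' ∈ (𝒜'.W a' : (R'.plus : Scheme.{0}).Opens)) ∧
          (∀ (a' : 𝒜'.ι) (e : ℕ),
            (∀ χ : Fin S.j → ℤ, ∃ s ∈ S.atlas.piece (oc a') (e • χ), IsUnit (S.i.app (S.atlas.W (oc a')) s)) →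
            ∀ χ' : Fin (S.j + 1) → ℤ, ∃ s' ∈ 𝒜'.piece a' ((e * Dg) • χ'),
              IsUnit ((R'.strictTransformPlus S.i.ker).subschemeι.app (𝒜'.W a') s')) ∧
          ∀ a' : 𝒜'.ι,
            (∀ (χ : Fin S.j → ℤ) (s : Γ(S.Y, S.atlas.W (oc a'))), s ∈ S.atlas.piece (oc a') χ →
              R'.πPlus.appLE (S.atlas.W (oc a')) (𝒜'.W a') (hle a') s ∈
                𝒜'.piece a' (Fin.snoc (α := fun _ => ℤ) χ 0)) ∧
            tInvOn R' (𝒜'.W a') ∈ 𝒜'.piece a' (Fin.snoc (α := fun _ => ℤ) 0 (-1)) ∧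
            ∃ (β : Γ(S.Y, S.atlas.W (oc a'))) (η : Γ((R'.plus : Scheme.{0}), 𝒜'.W a')),
              β ∈ (R.piece Dg).ideal (S.atlas.W (oc a')) ∧ β ∈ S.atlas.piece (oc a') 0 ∧ IsUnit η ∧
              η ∈ 𝒜'.piece a' (Fin.snoc (α := fun _ => ℤ) 0 (Dg : ℤ)) ∧
              η * tInvOn R' (𝒜'.W a') ^ Dg = R'.πPlus.appLE (S.atlas.W (oc a')) (𝒜'.W a') (hle a') β ∧
              (∀ y' : (R'.plus : Scheme.{0}), y' ∈ (𝒜'.W a' : (R'.plus : Scheme.{0}).Opens) ↔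
                ∃ (O : (R'.plus : Scheme.{0}).affineOpens)
                  (hO : (O : (R'.plus : Scheme.{0}).Opens) ≤ R'.πPlus ⁻¹ᵁ (S.atlas.W (oc a') : S.Y.Opens)),
                  y' ∈ (O : (R'.plus : Scheme.{0}).Opens) ∧ ∃ η₀ : Γ((R'.plus : Scheme.{0}), O),
                    IsUnit η₀ ∧ η₀ * tInvOn R' O ^ Dg = R'.πPlus.appLE (S.atlas.W (oc a')) O hO β) ∧
              (∀ s ∈ 𝒜'.piece a' 0, ∃ (l : ℕ) (x : Γ(S.Y, S.atlas.W (oc a'))),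
                x ∈ (R.piece (Dg * l)).ideal (S.atlas.W (oc a')) ∧ x ∈ S.atlas.piece (oc a') 0 ∧
                  s * η ^ l * tInvOn R' (𝒜'.W a') ^ (Dg * l) =
                    R'.πPlus.appLE (S.atlas.W (oc a')) (𝒜'.W a') (hle a') x) ∧
              (∀ (l : ℕ) (x : Γ(S.Y, S.atlas.W (oc a'))), x ∈ (R.piece (Dg * l)).ideal (S.atlas.W (oc a')) →
                x ∈ S.atlas.piece (oc a') 0 → ∃ s ∈ 𝒜'.piece a' 0,
                  s * η ^ l * tInvOn R' (𝒜'.W a') ^ (Dg * l) =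
                    R'.πPlus.appLE (S.atlas.W (oc a')) (𝒜'.W a') (hle a') x) ∧
              (∀ x : Γ(S.Y, S.atlas.W (oc a')), R'.πPlus.appLE (S.atlas.W (oc a')) (𝒜'.W a') (hle a') x ∈
                (R'.strictTransformPlus S.i.ker).ideal (𝒜'.W a') → x * β ∈ S.i.ker.ideal (S.atlas.W (oc a'))) ∧
              ∃ b : Γ(S.V, S.atlas.U (oc a')),
                b ∈ ((((R.piece Dg).comap S.i).subschemeι ≫ S.q).ker).ideal (S.atlas.U (oc a')) ∧
                S.i.app (S.atlas.W (oc a')) β =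
                  S.q.appLE (S.atlas.U (oc a')) (S.i ⁻¹ᵁ (S.atlas.W (oc a'))) (S.atlas.preimage_eq (oc a')).le b ∧
                (𝒜'.U a' : V'.Opens) =
                  blowupChart ρ ((((R.piece Dg).comap S.i).subschemeι ≫ S.q).ker) (S.atlas.U (oc a')) b) →
        (Stage.InvDim₂ (⟨R'.plus, R'.πPlus ≫ S.f, (R'.strictTransformPlus S.i.ker).subscheme,
            (R'.strictTransformPlus S.i.ker).subschemeι, hlp', V', q', ρ ≫ S.g, hq', S.j + 1, 𝒜'⟩ : Stage k) ∧
          ∀ η' ∈ Stage.genSing₂ (⟨R'.plus, R'.πPlus ≫ S.f, (R'.strictTransformPlus S.i.ker).subscheme,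
            (R'.strictTransformPlus S.i.ker).subschemeι, hlp', V', q', ρ ≫ S.g, hq', S.j + 1, 𝒜'⟩ : Stage k),
            R'.πPlus.base η' ∈ S.genSing₂) →
        ∀ η' ∈ Stage.genSing₂ (⟨R'.plus, R'.πPlus ≫ S.f, (R'.strictTransformPlus S.i.ker).subscheme,
            (R'.strictTransformPlus S.i.ker).subschemeι, hlp', V', q', ρ ≫ S.g, hq', S.j + 1, 𝒜'⟩ : Stage k),
          R'.πPlus.base η' ∈ R.support →
            S.SuccOverCentreAt R ⟨R'.plus, R'.πPlus ≫ S.f, (R'.strictTransformPlus S.i.ker).subscheme,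
            (R'.strictTransformPlus S.i.ker).subschemeι, hlp', V', q', ρ ≫ S.g, hq', S.j + 1, 𝒜'⟩ R'.πPlus η' := by
  intro k _ _ _ S _ _ R hadm _ R' hR' _ _ _ _ hlp' Dg _ V' ρ _ _ _ q' hq' σX _ _ 𝒜' hind hbelow η' hη' hsupp
  exact succOverCentreAt_of_inducedAlongCover S R hadm R' hR' hlp' Dg V' ρ q' hq' 𝒜' hind η' hη' (hbelow.2 η' hη') hsupp

end Summit.ResolutionOfSingularities.ResolutionOfSingularities.Cruxes.HypersurfaceCentreConstruction.LocalEngine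


end
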